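import Mathlib
import HarnessLib
import Summits.CriticalPhenomena.CardyFormulaZ2.Theorems.CardyMagicRigidityMagicFormulaTHexCells
import Summits.CriticalPhenomena.CardyFormulaZ2.Theorems.CardyMagicRigidityMagicFormulaTStubCellBridge
import Summits.CriticalPhenomena.CardyFormulaZ2.Theorems.CardyMagicRigidityMagicFormulaTLogKernel
import Summits.CriticalPhenomena.CardyFormulaZ2.Theorems.CardyMagicRigidityMagicFormulaTRiemannLogEnergy
import Summits.CriticalPhenomena.CardyFormulaZ2.Theorems.CardyMagicRigidityNestingRigidityShellPotential
import Literature.Probability.Percolation.HexLatticeSegments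

/-!
# Riemann sums for the logarithmic energy (line `Sketch`, stub `stub_riemannLog`)

Crux `Summit.CriticalPhenomena.CardyFormulaZ2.Theses.CardyMagicRigidity.MagicFormulaT`
(stmt-CriticalPhenomena-4836), line `Sketch` (card `kac-window-vertex-operators`), stub
`stub_riemannLog` of the registered skeleton `Cruxes/MagicFormulaT/Lines/Sketch.lean`, proved
EXACTLY as registered (tree vocabulary only; the open Voronoi hexagon `H_x` of the unit lattice
is a local notation, as in `…MagicFormulaTHexCells`).

For an admissible density `f` (measurable, `|f| ≤ C`, `f = 0` off `‖z‖ ≤ R`, `∫ f = 0`), with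
`f_δ = δ² f(δ ·)`, cells `H_x`, charges `λ_x = ∫_{H_x} f_δ` and charge sites
`S_δ = triBall ⌈2(R/δ + 1)⌉₊`, the off-diagonal discrete energy
`Σ_{x ≠ y ∈ S_δ} λ_x λ_y log‖x − y‖` tends to `Q = ∬ log‖x − y‖ f(x) f(y)` as `δ → 0⁺`, with the
explicit rate `|Σ − Q| ≤ 160 π² C² R² (2|R| + 1) · δ` for `0 < δ ≤ 1`:

1. `Q = ∬ log‖w − w'‖ f_δ(w) f_δ(w')` exactly (`riemannLog_energyDilation`,
   `…MagicFormulaTRiemannLogEnergy`);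
2. both this energy and its Coulomb majorant `80 ∬ |f_δ(w)||f_δ(w')|/‖w − w'‖` decompose over
   the pairs of cells of `S_δ` (`energy_eq_sum_sum`, `…MagicFormulaTLogKernel`; `f_δ` vanishes
   a.e. off these cells, `ae_dilate_eq_zero_off_cells`);
3. pair by pair, `λ_x λ_y ℓ̃_{xy} − ∫_{H_x} f_δ ∫_{H_y} log‖w − w'‖ f_δ = ∫_{H_x} f_δ(w) ∫_{H_y}
   (ℓ̃_{xy} − log‖w − w'‖) f_δ(w')` is dominated by the majorant (`abs_logCoeff_sub_log_le`:
   `|ℓ̃_{xy} − log‖w − w'‖| ≤ 80/‖w − w'‖` on `H_x × H_y`);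
4. the majorant is `≤ 80 · ‖f_δ‖₁ · sup_w ∫ |f_δ(w')|/‖w − w'‖ dw' ≤ 80 · (δ²C π R²/δ²) ·
   δ²C · 2π(2|R|/δ + 1) = O(δ)` (`∫_{B(0,r)} ‖v‖⁻¹ = 2πr`, `setIntegral_norm_inv_ball`).

No named facts are used; everything is proved tree / Mathlib material.
-/

noncomputable section

namespace Summit.CriticalPhenomena.CardyFormulaZ2.Cruxes.MagicFormulaT.LineSketch

open MeasureTheory Filter Finset Set Metric
open scoped Real Topology BigOperators
open Literature.Probability.RandomPlanarGeometry Literature.Probability.Percolation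
  Literature.Probability.LatticeModels
open Summit.CriticalPhenomena.CardyFormulaZ2.Cruxes.NestingRigidity.RingCloudTomography
  (integrableOn_log_norm_ball)

/-- The open Voronoi hexagon of the site `x` of the unit lattice (local notation, not a definition:
the stub is stated with this set written inline). -/
local notation3 (prettyPrint := false) "𝓗[" x "]" =>
  {z : ℂ | ∀ i : Fin 3, |hform i (z - triMeshPoint 1 x)| < 1}

/-! ## The Coulomb kernel `80/‖·‖` -/

/-- The Coulomb kernel `80/‖·‖` is integrable on discs. -/
theorem integrableOn_coulomb_ball (r : ℝ) : IntegrableOn (fun v : ℂ ↦ 80 * ‖v‖⁻¹) (ball 0 r) :=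
  (integrableOn_norm_inv_ball r).const_mul 80

/-- The Coulomb kernel is measurable. -/
theorem measurable_coulomb : Measurable fun t : ℝ ↦ 80 * t⁻¹ :=
  measurable_inv.const_mul 80

/-- `∫_{B(0,r)} |80/‖v‖| dv = 160 π r`. -/
theorem setIntegral_abs_coulomb_ball {r : ℝ} (hr : 0 ≤ r) :
    ∫ v in ball (0 : ℂ) r, |80 * ‖v‖⁻¹| = 160 * π * r := by
  have : ∀ v : ℂ, |80 * ‖v‖⁻¹| = 80 * ‖v‖⁻¹ := fun v ↦ abs_of_nonneg (by positivity)
  simp_rw [this]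
  rw [integral_const_mul, setIntegral_norm_inv_ball hr]
  ring

/-! ## The error of one pair of cells, and of the Riemann sum -/

section PairError

variable {g : ℂ → ℝ} {B ρ : ℝ}

/-- **Error of one pair of cells**: with `λ_x = ∫_{H_x} g` and `ℓ̃_{xy} = log‖x − y‖` (`x ≠ y`),
`0` (`x = y`): `|λ_x λ_y ℓ̃_{xy} − ∫_{H_x} g(w) ∫_{H_y} log‖w − w'‖ g(w')|
≤ ∫_{H_x} |g(w)| ∫_{H_y} 80 |g(w')|/‖w − w'‖` (combine into
`∫_{H_x} g(w) ∫_{H_y} (ℓ̃_{xy} − log‖w − w'‖) g(w')` and apply the Coulomb majorant). -/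
theorem abs_pair_sub_le (hg : Measurable g) (hB : ∀ z, |g z| ≤ B) (hρ : ∀ z, ρ < ‖z‖ → g z = 0)
    (x y : Site 2) :
    |(∫ w in 𝓗[x], g w) * (∫ w' in 𝓗[y], g w') *
        (if x = y then 0 else Real.log ‖triMeshPoint 1 x - triMeshPoint 1 y‖) -
      ∫ w in 𝓗[x], g w * ∫ w' in 𝓗[y], Real.log ‖w - w'‖ * g w'| ≤
      ∫ w in 𝓗[x], |g w| * ∫ w' in 𝓗[y], 80 * ‖w - w'‖⁻¹ * |g w'| := by
  set c := (if x = y then 0 else Real.log ‖triMeshPoint 1 x - triMeshPoint 1 y‖) with hc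
  have hgi : Integrable g := integrable_of_bdd_of_supp hg hB hρ
  have hlog : ∀ r, IntegrableOn (fun v : ℂ ↦ Real.log ‖v‖) (ball 0 r) :=
    fun r ↦ integrableOn_log_norm_ball r
  have hg' : Measurable fun z ↦ |g z| := continuous_abs.measurable.comp hg
  have hB' : ∀ z, |(fun z ↦ |g z|) z| ≤ B := fun z ↦ by simp only [abs_abs]; exact hB z
  have hρ' : ∀ z, ρ < ‖z‖ → (fun z ↦ |g z|) z = 0 := fun z hz ↦ by
    simp only [hρ z hz, abs_zero]
  have hLint : ∀ w, Integrable (fun w' ↦ Real.log ‖w - w'‖ * g w') :=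
    integrable_kernel_mul (κ := Real.log) hlog hg hB hρ
  have hΦint : ∀ w, Integrable (fun w' ↦ 80 * ‖w - w'‖⁻¹ * |g w'|) :=
    integrable_kernel_mul (κ := fun t ↦ 80 * t⁻¹) (g := fun z ↦ |g z|)
      integrableOn_coulomb_ball hg' hB' hρ'
  -- the product term as an iterated integral
  have hA : (∫ w in 𝓗[x], g w) * (∫ w' in 𝓗[y], g w') * c =
      ∫ w in 𝓗[x], g w * ∫ w' in 𝓗[y], c * g w' := by
    rw [integral_const_mul, integral_mul_const]
    ring
  -- combine the two iterated integrals
  have hI1 : IntegrableOn (fun w ↦ g w * ∫ w' in 𝓗[y], c * g w') 𝓗[x] :=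
    (hgi.mul_const _).integrableOn
  have hI2 : IntegrableOn (fun w ↦ g w * ∫ w' in 𝓗[y], Real.log ‖w - w'‖ * g w') 𝓗[x] :=
    (integrable_mul_setIntegral_kernel Real.measurable_log hlog hg hB hρ _).integrableOn
  have hcomb : (∫ w in 𝓗[x], g w * ∫ w' in 𝓗[y], c * g w') -
      (∫ w in 𝓗[x], g w * ∫ w' in 𝓗[y], Real.log ‖w - w'‖ * g w') =
      ∫ w in 𝓗[x], g w * ∫ w' in 𝓗[y], (c - Real.log ‖w - w'‖) * g w' := by
    rw [← integral_sub hI1 hI2]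
    refine integral_congr_ae (ae_of_all _ fun w ↦ ?_)
    dsimp only
    rw [← mul_sub, ← integral_sub (hgi.const_mul c).integrableOn (hLint w).integrableOn]
    congr 1
    refine integral_congr_ae (ae_of_all _ fun w' ↦ ?_)
    ring
  rw [hA, hcomb]
  -- the Coulomb majorant, under both integrals
  rw [← Real.norm_eq_abs]
  refine norm_integral_le_of_norm_le ((integrable_mul_setIntegral_kernel (κ := fun t ↦ 80 * t⁻¹)
    (g := fun z ↦ |g z|) measurable_coulomb integrableOn_coulomb_ball hg' hB' hρ' _).integrableOn)
    ?_
  refine (ae_restrict_iff' (measurableSet_hexCell x)).2 (ae_of_all _ fun w hw ↦ ?_)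
  rw [norm_mul, Real.norm_eq_abs, Real.norm_eq_abs]
  refine mul_le_mul_of_nonneg_left ?_ (abs_nonneg _)
  rw [← Real.norm_eq_abs]
  refine norm_integral_le_of_norm_le (hΦint w).integrableOn ?_
  refine (ae_restrict_iff' (measurableSet_hexCell y)).2 (ae_of_all _ fun w' hw' ↦ ?_)
  rw [norm_mul, Real.norm_eq_abs, Real.norm_eq_abs]
  exact mul_le_mul_of_nonneg_right (abs_logCoeff_sub_log_le x y hw hw') (abs_nonneg _)

/-- **Error of the Riemann sum against the energy of `g`**: if `|g| ≤ B`, `g = 0` off `B̄(0, ρ)`,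
`ρ ≥ 0`, and `g` vanishes a.e. off the cells of `S`, then
`|Σ_{x ≠ y ∈ S} λ_x λ_y log‖x − y‖ − ∬ log‖w − w'‖ g g| ≤ 160 π² B² ρ² (2ρ + 1)`. -/
theorem abs_riemannSum_sub_energy_le (hg : Measurable g) (hB : ∀ z, |g z| ≤ B)
    (hρ : ∀ z, ρ < ‖z‖ → g z = 0) (hρ0 : 0 ≤ ρ) (S : Finset (Site 2))
    (hcover : ∀ᵐ z ∂(volume : Measure ℂ), z ∉ (⋃ x ∈ S, 𝓗[x]) → g z = 0) :
    |(∑ x ∈ S, ∑ y ∈ S, if x = y then 0 else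
        (∫ w in 𝓗[x], g w) * (∫ w in 𝓗[y], g w) *
          Real.log ‖triMeshPoint 1 x - triMeshPoint 1 y‖) -
      ∫ w, ∫ w', Real.log ‖w - w'‖ * g w * g w'| ≤
      160 * π ^ 2 * B ^ 2 * ρ ^ 2 * (2 * ρ + 1) := by
  have hB0 : 0 ≤ B := (abs_nonneg _).trans (hB 0)
  have hgi : Integrable g := integrable_of_bdd_of_supp hg hB hρ
  have hlog : ∀ r, IntegrableOn (fun v : ℂ ↦ Real.log ‖v‖) (ball 0 r) :=
    fun r ↦ integrableOn_log_norm_ball r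
  have hg' : Measurable fun z ↦ |g z| := continuous_abs.measurable.comp hg
  have hB' : ∀ z, |(fun z ↦ |g z|) z| ≤ B := fun z ↦ by simp only [abs_abs]; exact hB z
  have hρ' : ∀ z, ρ < ‖z‖ → (fun z ↦ |g z|) z = 0 := fun z hz ↦ by
    simp only [hρ z hz, abs_zero]
  have hcover' : ∀ᵐ z ∂(volume : Measure ℂ), z ∉ (⋃ x ∈ S, 𝓗[x]) → (fun z ↦ |g z|) z = 0 := by
    filter_upwards [hcover] with z hz hzU
    simp only [hz hzU, abs_zero]
  -- both the energy and the majorant decompose over pairs of cells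
  rw [energy_eq_sum_sum Real.measurable_log hlog hg hB hρ S hcover]
  have hP := energy_eq_sum_sum (κ := fun t ↦ 80 * t⁻¹) (g := fun z ↦ |g z|) measurable_coulomb
    integrableOn_coulomb_ball hg' hB' hρ' S hcover'
  -- termwise comparison
  have hterm : ∀ x y : Site 2,
      |(if x = y then 0 else (∫ w in 𝓗[x], g w) * (∫ w in 𝓗[y], g w) *
          Real.log ‖triMeshPoint 1 x - triMeshPoint 1 y‖) -
        ∫ w in 𝓗[x], g w * ∫ w' in 𝓗[y], Real.log ‖w - w'‖ * g w'| ≤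
      ∫ w in 𝓗[x], |g w| * ∫ w' in 𝓗[y], 80 * ‖w - w'‖⁻¹ * |g w'| := by
    intro x y
    have e : (if x = y then 0 else (∫ w in 𝓗[x], g w) * (∫ w in 𝓗[y], g w) *
        Real.log ‖triMeshPoint 1 x - triMeshPoint 1 y‖) =
        (∫ w in 𝓗[x], g w) * (∫ w' in 𝓗[y], g w') *
          (if x = y then 0 else Real.log ‖triMeshPoint 1 x - triMeshPoint 1 y‖) := by
      split_ifs <;> simp
    rw [e]
    exact abs_pair_sub_le hg hB hρ x y
  -- the majorant at one point: `∫ 80 |g(w')|/‖w − w'‖ dw' ≤ 160 π B (2ρ + 1)` on `supp g`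
  have hpt : ∀ w, |g w| * ∫ w', 80 * ‖w - w'‖⁻¹ * |g w'| ≤
      |g w| * (B * (160 * π * (2 * ρ + 1))) := by
    intro w
    by_cases hw : g w = 0
    · simp [hw]
    refine mul_le_mul_of_nonneg_left ?_ (abs_nonneg _)
    have hwρ : ‖w‖ ≤ ρ := by
      by_contra h
      exact hw (hρ w (not_le.1 h))
    have h1 : ∫ w', 80 * ‖w - w'‖⁻¹ * |g w'| =
        ∫ w', |80 * ‖w - w'‖⁻¹| * |(fun z ↦ |g z|) w'| := by
      refine integral_congr_ae (ae_of_all _ fun w' ↦ ?_)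
      simp only [abs_abs, abs_of_nonneg (show (0 : ℝ) ≤ 80 * ‖w - w'‖⁻¹ by positivity)]
    rw [h1]
    refine (integral_abs_kernel_mul_le (κ := fun t ↦ 80 * t⁻¹) integrableOn_coulomb_ball
      hB' hρ' w).trans ?_
    have hr0 : 0 ≤ ‖w‖ + ρ + 1 := by positivity
    rw [setIntegral_abs_coulomb_ball hr0]
    refine mul_le_mul_of_nonneg_left ?_ hB0
    nlinarith [Real.pi_pos, norm_nonneg w]
  -- the majorant in total: `≤ 160 π B (2ρ + 1) ‖g‖₁ ≤ 160 π² B² ρ² (2ρ + 1)`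
  have hmaj : ∫ w, ∫ w', 80 * ‖w - w'‖⁻¹ * |g w| * |g w'| ≤
      160 * π ^ 2 * B ^ 2 * ρ ^ 2 * (2 * ρ + 1) := by
    have e1 : ∀ w, ∫ w', 80 * ‖w - w'‖⁻¹ * |g w| * |g w'| =
        |g w| * ∫ w', 80 * ‖w - w'‖⁻¹ * |g w'| := by
      intro w
      rw [← integral_const_mul]
      refine integral_congr_ae (ae_of_all _ fun w' ↦ ?_)
      ring
    simp_rw [e1]
    have hint : Integrable (fun w ↦ |g w| * ∫ w', 80 * ‖w - w'‖⁻¹ * |g w'|) := by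
      have := integrable_mul_setIntegral_kernel (κ := fun t ↦ 80 * t⁻¹) (g := fun z ↦ |g z|)
        measurable_coulomb integrableOn_coulomb_ball hg' hB' hρ' Set.univ
      simpa only [Measure.restrict_univ] using this
    calc ∫ w, |g w| * ∫ w', 80 * ‖w - w'‖⁻¹ * |g w'|
        ≤ ∫ w, |g w| * (B * (160 * π * (2 * ρ + 1))) :=
          integral_mono hint (hgi.abs.mul_const _) hpt
      _ = (∫ w, |g w|) * (B * (160 * π * (2 * ρ + 1))) := integral_mul_const _ _
      _ ≤ B * (π * ρ ^ 2) * (B * (160 * π * (2 * ρ + 1))) :=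
          mul_le_mul_of_nonneg_right (integral_abs_le_of_bdd_of_supp hB hρ hρ0) (by positivity)
      _ = 160 * π ^ 2 * B ^ 2 * ρ ^ 2 * (2 * ρ + 1) := by ring
  -- assemble
  calc |(∑ x ∈ S, ∑ y ∈ S, if x = y then 0 else
          (∫ w in 𝓗[x], g w) * (∫ w in 𝓗[y], g w) *
            Real.log ‖triMeshPoint 1 x - triMeshPoint 1 y‖) -
        ∑ x ∈ S, ∑ y ∈ S, ∫ w in 𝓗[x], g w * ∫ w' in 𝓗[y], Real.log ‖w - w'‖ * g w'|
      = |∑ x ∈ S, ∑ y ∈ S, ((if x = y then 0 else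
          (∫ w in 𝓗[x], g w) * (∫ w in 𝓗[y], g w) *
            Real.log ‖triMeshPoint 1 x - triMeshPoint 1 y‖) -
          ∫ w in 𝓗[x], g w * ∫ w' in 𝓗[y], Real.log ‖w - w'‖ * g w')| := by
        simp only [Finset.sum_sub_distrib]
    _ ≤ ∑ x ∈ S, ∑ y ∈ S, |(if x = y then 0 else
          (∫ w in 𝓗[x], g w) * (∫ w in 𝓗[y], g w) *
            Real.log ‖triMeshPoint 1 x - triMeshPoint 1 y‖) -
          ∫ w in 𝓗[x], g w * ∫ w' in 𝓗[y], Real.log ‖w - w'‖ * g w'| := by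
        refine (Finset.abs_sum_le_sum_abs _ _).trans (Finset.sum_le_sum fun x _ ↦ ?_)
        exact Finset.abs_sum_le_sum_abs _ _
    _ ≤ ∑ x ∈ S, ∑ y ∈ S, ∫ w in 𝓗[x], |g w| * ∫ w' in 𝓗[y], 80 * ‖w - w'‖⁻¹ * |g w'| :=
        Finset.sum_le_sum fun x _ ↦ Finset.sum_le_sum fun y _ ↦ hterm x y
    _ = ∫ w, ∫ w', 80 * ‖w - w'‖⁻¹ * |g w| * |g w'| := hP.symm
    _ ≤ 160 * π ^ 2 * B ^ 2 * ρ ^ 2 * (2 * ρ + 1) := hmaj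

end PairError

/-! ## The stub -/

section Stub

variable {f : ℂ → ℝ} {R C : ℝ}

/-- **Quantitative Riemann-sum bound**: for admissible neutral `f` and `0 < δ ≤ 1`, the
off-diagonal discrete energy of the cell charges of `f_δ = δ² f(δ ·)` on `triBall ⌈2(R/δ + 1)⌉₊`
is within `160 π² C² R² (2|R| + 1) · δ` of `∬ log‖x − y‖ f(x) f(y)`. -/
theorem abs_riemannSum_dilate_sub_le (hf : Measurable f) (hC : ∀ z, |f z| ≤ C)
    (hR : ∀ z, R < ‖z‖ → f z = 0) (h0 : ∫ z, f z = 0) {δ : ℝ} (hδ : 0 < δ) (hδ1 : δ ≤ 1) :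
    |(∑ x ∈ triBall ⌈2 * (R / δ + 1)⌉₊, ∑ y ∈ triBall ⌈2 * (R / δ + 1)⌉₊,
        if x = y then 0 else
          (∫ z in 𝓗[x], δ ^ 2 * f ((δ : ℂ) * z)) * (∫ z in 𝓗[y], δ ^ 2 * f ((δ : ℂ) * z)) *
          Real.log ‖triMeshPoint 1 x - triMeshPoint 1 y‖) -
      ∫ x, ∫ y, Real.log ‖x - y‖ * f x * f y| ≤
      160 * π ^ 2 * C ^ 2 * R ^ 2 * (2 * |R| + 1) * δ := by
  have key := abs_riemannSum_sub_energy_le (measurable_dilate hf δ) (abs_dilate_le hC δ)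
    (dilate_eq_zero_of_lt_norm hR hδ) (by positivity) (triBall ⌈2 * (R / δ + 1)⌉₊)
    (ae_dilate_eq_zero_off_cells hR hδ)
  rw [riemannLog_energyDilation f R C δ hf hC hR h0 hδ] at key
  have e : 160 * π ^ 2 * (δ ^ 2 * C) ^ 2 * (|R| / δ) ^ 2 * (2 * (|R| / δ) + 1) =
      160 * π ^ 2 * C ^ 2 * R ^ 2 * (2 * |R| * δ + δ ^ 2) := by
    rw [← sq_abs R]
    field_simp
  rw [e] at key
  refine key.trans ?_
  have h1 : 2 * |R| * δ + δ ^ 2 ≤ (2 * |R| + 1) * δ := by nlinarith [abs_nonneg R]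
  have h2 : 0 ≤ 160 * π ^ 2 * C ^ 2 * R ^ 2 := by positivity
  calc 160 * π ^ 2 * C ^ 2 * R ^ 2 * (2 * |R| * δ + δ ^ 2)
      ≤ 160 * π ^ 2 * C ^ 2 * R ^ 2 * ((2 * |R| + 1) * δ) := mul_le_mul_of_nonneg_left h1 h2
    _ = 160 * π ^ 2 * C ^ 2 * R ^ 2 * (2 * |R| + 1) * δ := by ring

/-- **Stub `stub_riemannLog` of line `Sketch` (crux `MagicFormulaT`): Riemann sums for the
logarithmic energy.**  For admissible neutral `f`, the off-diagonal discrete energy of the cell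
charges of `f_δ` tends to `∬ log‖x − y‖ f(x) f(y)` as `δ → 0⁺`: the energy of `f_δ` at mesh `1`
equals that of `f` exactly (neutrality kills `log δ`), it decomposes over pairs of cells, and
the pair errors are dominated by the Coulomb energy `80 ∬ |f_δ||f_δ|/‖w − w'‖ = O(δ)`. -/
theorem stub_riemannLog : ∀ (f : ℂ → ℝ) (R C : ℝ), Measurable f → (∀ z, |f z| ≤ C) →
    (∀ z, R < ‖z‖ → f z = 0) → ∫ z, f z = 0 →
    Tendsto (fun δ : ℝ ↦ ∑ x ∈ triBall ⌈2 * (R / δ + 1)⌉₊, ∑ y ∈ triBall ⌈2 * (R / δ + 1)⌉₊,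
        if x = y then 0 else
          (∫ z in {z : ℂ | ∀ i : Fin 3, |hform i (z - triMeshPoint 1 x)| < 1}, δ ^ 2 * f ((δ : ℂ) * z)) *
          (∫ z in {z : ℂ | ∀ i : Fin 3, |hform i (z - triMeshPoint 1 y)| < 1}, δ ^ 2 * f ((δ : ℂ) * z)) *
          Real.log ‖triMeshPoint 1 x - triMeshPoint 1 y‖)
      (𝓝[>] 0) (𝓝 (∫ x, ∫ y, Real.log ‖x - y‖ * f x * f y)) := by
  intro f R C hf hC hR h0
  set A : ℝ := 160 * π ^ 2 * C ^ 2 * R ^ 2 * (2 * |R| + 1) with hA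
  have hA0 : 0 ≤ A := by positivity
  rw [Metric.tendsto_nhds]
  intro ε hε
  have hmem : Set.Ioo (0 : ℝ) (min 1 (ε / (A + 1))) ∈ 𝓝[>] (0 : ℝ) :=
    Ioo_mem_nhdsGT (lt_min one_pos (div_pos hε (by positivity)))
  filter_upwards [hmem] with δ hδ
  have hδ0 : 0 < δ := hδ.1
  have hδ1 : δ ≤ 1 := (hδ.2.trans_le (min_le_left _ _)).le
  have hδε : δ < ε / (A + 1) := hδ.2.trans_le (min_le_right _ _)
  rw [Real.dist_eq]
  calc _ ≤ A * δ := abs_riemannSum_dilate_sub_le hf hC hR h0 hδ0 hδ1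
    _ ≤ (A + 1) * δ := by nlinarith
    _ < (A + 1) * (ε / (A + 1)) := mul_lt_mul_of_pos_left hδε (by positivity)
    _ = ε := mul_div_cancel₀ _ (by positivity)

end Stub

end Summit.CriticalPhenomena.CardyFormulaZ2.Cruxes.MagicFormulaT.LineSketch

end
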